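import Mathlib
import HarnessLib
import HarnessLib.Audit
import Summits.RiemannHypothesis.Statement
import Literature.NumberTheory.LFunctions.DeBruijnNewman
import Literature.NumberTheory.LFunctions.DeBruijnHDiv
import Literature.NumberTheory.LFunctions.DeBruijnHZeroProofs
import Literature.NumberTheory.LFunctions.RiemannXiProofs
import Summits.RiemannHypothesis.RiemannHypothesis.Theorems.UniversalFactorWideKernelNoGoStandalone
import Summits.RiemannHypothesis.RiemannHypothesis.Theorems.UniversalFactorLaguerreLiftStandalone
import Summits.RiemannHypothesis.RiemannHypothesis.Theorems.UniversalFactorWideTailLinkStandalone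
import Summits.RiemannHypothesis.RiemannHypothesis.Theorems.UniversalFactorMixedFactorReductionStandalone
import Summits.RiemannHypothesis.RiemannHypothesis.Theorems.UniversalFactorAssemblyStandalone
import HarnessLib.Audit.Status.Attr

/-!
Route: UniversalFactor

CLOSED (refuted) 2026-08-16T18:41:21Z by planner-rfix-RiemannHypothesis-UniversalFact-2d4ede49-0 — reason: refuted:stmt-RiemannHypothesis-2575 (LaplaceLoophole) by Summit.RiemannHypothesis.RiemannHypothesis.Theorems.UniversalFactorLaplaceLoophole_refuted — note: Summit.RiemannHypothesis.RiemannHypothesis.Theorems.UniversalFactorLaplaceLoophole_refuted (@7822bbd143ca, refuter-lscan-RiemannHypothesis-2575-r081616); substantive: the closes hypothesis LaplaceLoophole (∃ a>0, F_a = deBruijnHDiv(1+u²/a²) real-rooted) is false at EVERY a>0 via the route's own type. The file is kept as the record of this route; refuted decls are indexed as negative knowledge (`ledger negatives`).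

# Route UniversalFactor — Cardon's loophole decided — Laplace-smoothed Ξ, the Laguerre lift to RH,
and generalised Newman in every Pólya-frequency direction

Realises card universal-factor-newman-every-direction (absorbing
generalised-newman-universal-factor-minimality and borcea-branden-monoid-op-rays). With Φ =
`deBruijnPhi` (Rodgers–Tao normalisation, `H_0(z) = ∫₀^∞ Φ(u) cos(zu) du = ξ(1/2+iz/2)/8`, zeta zero
γ ↔ z = 2γ) put, for a > 0,
F_a(z) := ∫₀^∞ Φ(u) (1 + u²/a²)⁻¹ cos(zu) du — the de Bruijn transform of Φ DIVIDED by the universal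
factor 1 + u²/a², equivalently the Laplace(a)-smoothing F_a = H_0 * (a/2)e^{−a|·|} = E[H_0(· + X)],
X ~ Laplace(rate a), with H_0 = F_a − F_a''/a².
Thesis X (the loophole, Cardon's Question 7 made precise): it suffices to show that for ONE a > 0
the entire function F_a has only real zeros. Indeed (1 − D²/a²) = (1 − D/a)(1 + D/a) preserves
real-rootedness of real entire functions of order < 2 (Laguerre; Hadamard-free in the tree via
LaguerrePolya.lean), so X gives `HasOnlyRealZeros (deBruijnH 0)`, which is RH by the PROVED fact
`riemannHypothesis_iff_hasOnlyRealZeros_deBruijnH_zero_holds`. By MixedFactorReduction (support) the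
one-parameter Laplace family already carries the whole non-Gaussian part of de Bruijn's
universal-factor cone (real-rootedness propagates up the divisibility order S | S'), and the
Gaussian ray is closed by `rodgers_tao_holds` (Λ ≥ 0, proved in tree along Dobner); so X is exactly
"some Pólya-frequency smoothing of Ξ is Laguerre–Pólya". X is strictly stronger than RH and is
EXPECTED FALSE (generalised Newman conjecture GN: RH, if true, is barely true in every
Laguerre–Pólya direction); the route is a two-sided DECISION route: its assembly is a theorem to
prove now, its ranked cruxes decide X window by window (wide a < π/8: residue theorem; medium π/8 ≤
a ≤ 32: certified computation; narrow a ≥ 32: the Riemann–Siegel reweighting / band-limit theorem),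
and the expected end state is X refuted with every crux a new barrier theorem
`UniversalFactorNewman` extending `Literature.Barriers.RiemannHypothesis.NewmanConjecture` from the
heat ray to the whole cone.
Lean: `∃ a : ℝ, 0 < a ∧ Literature.NumberTheory.LFunctions.HasOnlyRealZeros (fun z : ℂ => ∫ u in
Set.Ioi (0:ℝ), ((Literature.NumberTheory.LFunctions.deBruijnPhi u / (1 + u ^ 2 / a ^ 2) : ℝ) : ℂ) *
Complex.cos (z * u))`

## Assembly
X → RH is LaguerreLift (Laguerre's theorem for (1 − D²/a²) on real entire functions of order < 2,
plus the identity (1 − D²/a²)F_a = H_0) followed by the PROVED tree fact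
`Literature.NumberTheory.LFunctions.riemannHypothesis_iff_hasOnlyRealZeros_deBruijnH_zero_holds` (RH
↔ H_0 has only real zeros) and `Summit.RiemannHypothesis_iff`. Checked in Sketch.lean: `example (hL
: LaguerreLift) : Assembly` elaborates (rc 0). Every fact in the assembly's cone is proved
(deBruijnH_zero_eq_holds, thm10_holds, LaguerrePolya.lean); no named hypothesis is needed. The kill
path is also typed there: NarrowKernelNoGo → MediumKernelNoGo → WideKernelNoGo → ExceptionalWideNoGo
→ ¬LaplaceLoophole (case split at π/8 and 32).

Rationale: WHY THIS LINE. Mechanism: de Bruijn's universal factors S(u) = e^{λu²}∏(1+u²/a_k²) are exactly the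
kernel multipliers preserving real-rootedness of trigonometric integrals [Bruijn1950;
BrandenChasse2017], i.e. 1/S is the characteristic function of a symmetric Pólya-frequency law
(Schoenberg), so dividing Φ by S is PF-smoothing of Ξ and Ξ = T_S F_S with T_S an LP-preserver; the
loophole "F_S ∈ LP for one non-trivial S ⇒ RH" is Cardon's Question 7 [Cardon2001 §3 Q7 p.1733:
'This would prove the Riemann Hypothesis! However, it seems unlikely…'], never decided. Newman's
conjecture Λ ≥ 0 [RodgersTaoFMP2020; Dobner2021; in tree `rodgers_tao_holds`] is precisely the
Gaussian ray of this question; no monotonicity transfers it to the Laplace rays ((1+u²/a²)e^{−λu²}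
is a universal factor in neither direction). Imports: (i) probability/total positivity (PF laws,
smoothing as expectation) for the dictionary; (ii) entire-function theory of order < 2 (Laguerre, de
Bruijn Thms 6/10/13 — all PROVED in tree: `thm6_holds`, `thm10_holds`, `rootsInStrip_zero_gaussian`,
`im_mul_im_logDeriv_le`) for the assembly; (iii) Riemann–Siegel/saddle-point analysis: the new
observation that division by 1+u²/a² multiplies the n-th Riemann–Siegel term by m(u*_n) = a²/(a² +
u*_n²), u*_n = ½log(N/n) + iπ/8, hence SUPPRESSES THE HEAD of the main sum once ¼log(t/2π) ≫ a, so
that F_a on the real axis is band-limited (local frequencies log(N/n) ≲ c·a) and can change sign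
only ≲ c·a/π times per unit t while its total zero count stays (1/2π)log t — Dobner's mechanism for
Λ ≥ 0 (his Gaussian factor e^{t u*²}, t < 0, suppresses the head too) transplanted from a fixed
Dirichlet series to a sliding-window sum, with Montgomery–Vaughan mean values
[MontgomeryVaughan1974] replacing Bohr almost-periodicity because the off-axis zeros are microscopic
(|Im z| ~ log log T/log T); (iv) Lehmer pairs and certified numerics [CsordasSmithVarga1994;
Polymath2019; PlattTrudgian2021] for the medium window. What it does that DBN / the cone card do
not: DBN and debruijn-cone-real-rooting-set work the FORWARD cone (multiply Φ by S, thresholds along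
rays, vertex = RH restated); this route works the INVERSE cone (divide), whose thesis is strictly
stronger than RH, refutable without touching RH, and whose refutation is a catalogue-grade no-go for
every kernel-side programme of the form 'Ξ = T[Ψ], T an LP-preserver, Ψ provably LP'. Negatives
index: empty at filing.

RANKED CRUXES. #0 LaplaceLoophole (target) — X: for some a > 0 the Laplace(a)-smoothed transform
F_a(z) = ∫₀^∞ Φ(u)(1+u²/a²)⁻¹cos(zu)du has only real zeros (Cardon's Question 7 on the minimal
non-Gaussian universal factors; by MixedFactorReduction + Λ ≥ 0 this is the whole universal-factor
loophole). (why it might fail: Expected FALSE (generalised Newman): wide a < π/8 killed by the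
residue at u = ia (WideKernelNoGo), medium a by Lehmer pairs / head-term dominance
(MediumKernelNoGo), narrow a by Riemann–Siegel head suppression (NarrowKernelNoGo); Cardon himself:
'seems unlikely'.) [Cardon2001, RodgersTaoFMP2020, Dobner2021, Bruijn1950] STATUS 2026-08-16:
numerically dead on (0, 39.7] — every a ∈ [0.30, 39.7] has an exhibited lost close pair of H_0-zeros
(kit j012972; Cruxes/LaplaceLoophole/BarrierNotes-r1-k1.md, NoPositiveLever-r2-k5.md) and the wide
regime is refuted in tree; positive ideation parked after two rounds (every positive stub set is
RH-strength: `UniversalFactor.riemannHypothesis_of_laplaceLoophole`); X is decided only through the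
typed kill path `UniversalFactor.not_laplaceLoophole_of_noGo`.
#2 NarrowKernelNoGo (crux) — Generalised Newman, narrow kernels: for every a ≥ 32, F_a has a
non-real zero (expected: ≫ T log T of its zeros up to height T are non-real once log T ≫ a).
Proposed proof = 'Dobner for the Laplace ray': (i) effective Riemann–Siegel/saddle asymptotics for
the modified kernel Φ(u)a²/(a²+u²) (poles ±ia stay outside the deformation region 0 ≤ Im u ≤ π/8;
templates: Polymath15 effective A+B, in-tree KKL files), F_a(x) = A(t)·2Re[e^{iθ(t)}Σ_{n≤N} m(u*_n)
n^{−1/2−it}] + O(A t^{−1/4}); (ii) the weights m(u*_n) = a²/(a²+(½log(N/n)+iπ/8)²) form a Lorentzian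
window of width ~a below log N, so on [T,2T] the main term G has ∫|G'|² ≤ (c a)²∫|G|² and a fourth
moment of the right order (Montgomery–Vaughan), giving an interval I of ≥ 3 mean spacings with |G| ≥
rms/4 of one sign once log T ≥ C·a; (iii) argument principle on I × [−1,1] where the n = 1 term
dominates off the axis: ≥ 2 zeros inside, none real. Alternative handles: the card's
interlacing-charge identity; the phase/Lehmer mechanism under pair-correlation-type input
(`MontgomeryPairCorrelation.smallGaps`). [difficulty: XL] (why it might fail: Band-limit heuristic
must survive rigorous errors uniformly in a: needs F_a = A·G + o(rms G) on a positive-measure set at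
height e^{Ca} and an ∫|G'|² bound; if sign changes of G ignore its bandwidth (wild backtracking),
only open small-gap inputs (μ_min ≲ (log T)^{-1/2}) remain.) [Dobner2021, RodgersTaoFMP2020,
Polymath2019, MontgomeryVaughan1974, KiKimLee2009, CsordasSmithVarga1994] STATUS 2026-08-16: [32,
37.47) is already covered by the lost Lehmer-7005 pair and every FIXED larger a by a closer pair (γ
≈ 17143.8 kills a < 40.0; lost-pair law a* ≈ 2√2/(z-gap), NoPositiveLever-r2-k5.md §3), so the
crux's entire content is a-UNIFORMITY as a → ∞; nearest prior art for the head suppression: Ivić's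
convolution functions M_{Z,f} at fixed G [arXiv:math/0311162 §§6–9].
#3 MediumKernelNoGo (crux) — Generalised Newman, medium kernels, by certified computation: for every
a with π/8 ≤ a ≤ 32, F_a has a non-real zero. Plan: finitely many certified non-real zeros z_j(a)
(interval arithmetic for F_a(z) = (a/2)∫ H_0(z−y)e^{−a|y|}dy from ball-arithmetic ξ, argument
principle on small boxes) plus a-continuity tracking on overlapping a-intervals: a ∈ [π/8, ~3] from
the band-limited regime at heights t ≤ 2πe^{4a}·C ≤ 10⁶ (for a just above π/8 even t ≤ 400: the head
term (a/2)e^{−ax}∫H_0e^{aw} dominates and F_a > 0 below X₀(a) while N(X₀) zeros sit in the disc); a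
∈ [3, 6] from low close pairs (z-gap < 2.8/a with 1/a ≤ 0.1 × spacing) or band-limit heights ≤
10^{11}; a ∈ [6, 32] from Lehmer's pair γ = 7005.063/7005.101 (z-gap 0.0754 < 2√2/a for a < 37.5;
1/a ≤ 0.17 ≪ spacing 1.79): the Laplace variance 2/a² fills the dip, Rouché on a box of size ~1
preserves the local count 2. [deps: LehmerPointNoGo] [difficulty: L] (why it might fail: Coverage
gap: an a-window (likely in [3,6]) where no catalogued close pair and no reachable band-limit height
gives a certifiable non-real zero; relative-precision evaluation of F_a where |H_0| ~ 10^{-2390}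
(ratios only, but the certificate must carry it); Lean certificate import.) [CsordasSmithVarga1994,
Polymath2019, PlattTrudgian2021, doi:10.1090/s0025-5718-2011-02472-5, Cardon2001] STATUS 2026-08-16
— answers the judge's 'what would move it: MediumKernelNoGo failing at some a': it fails at NO a.
Standing-disprover verdict NO-KILL on the whole window (Cruxes/MediumKernelNoGo/Disproof.lean §6):
the lost Lehmer-7005 pair gives a tracked non-real zero z(a) ≈ 14010.16 + i·y(a), y(a) ≈ √(2/a² −
δ²), for a ∈ [1.5, 37.47), winding number 1 checked at a = 3, 6, 16, 32; low-height non-real zeros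
(x < 250; e.g. 48.77 + 1.76i at a = π/8, 153.56 + 0.17i at a = 1) together with the Lehmer bracket,
valid down to a = 1 (evidence-atlas j005080), cover a ∈ [π/8, 1.5]. The three planned regimes
collapse to two certificate families, the feared [3,6] gap does not exist, and the lead line
one-sided-average-sign-test (Cruxes/MediumKernelNoGo/PICKED.md) reduces the crux to two pointwise
certificate stubs consumed by `UniversalFactor.mediumKernelNoGo_of_certificates` /
`laguerreForm_nonneg`. All remaining risk is certification engineering, none is truth.
#4 WideKernelNoGo (crux) — Generalised Newman, wide kernels (regime A): for 0 < a < π/8, if ∫₀^∞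
H_0(x)cosh(ax)dx ≠ 0 (i.e. Φ(ia) ≠ 0; Φ continues to |Im u| < π/8) then F_a has a non-real zero — in
fact infinitely many: by WideKernelTail F_a(x) = a e^{−a|x|}(∫₀^∞H_0 cosh(a·) + o(1)), so F_a has
finitely many real zeros, while F_a is real entire of order < 2 (de Bruijn Thm 10, `thm10_holds`)
and not of exponential type (F_a(iy) = ∫Φ cosh(yu)/(1+u²/a²) ≥ c_U e^{yU} for every U since Φ > 0),
hence has infinitely many zeros (zero-free order-<2 real entire functions are e^{αz+β}:
Borel–Carathéodory, Mathlib `Complex.borelCaratheodory`). Each instance is a new barrier theorem: no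
WIDE Pólya-frequency smoothing of Ξ is Laguerre–Pólya. [deps: WideKernelTail] [difficulty: M] (why
it might fail: Low risk, new but elementary: needs the decay |H_0(x)| ≪ x^A e^{−πx/8} (Ξ(t) ≪
t^{7/4}e^{−πt/4}) to justify F_a = H_0 * Laplace(a) and dominated convergence; fails only through a
normalisation slip (π/8 is the RT strip; Titchmarsh's is π/4).) [Bruijn1950, Titchmarsh1986,
Cardon2001, RodgersTaoFMP2020] STATUS: PROVED (`UniversalFactorStandalone.wideKernelNoGo`, item
closed).
#9 LaguerreLift (support) — The LP-preserver step behind the assembly: for every a > 0, if F_a has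
only real zeros then so has H_0 = (1 − D²/a²)F_a. Proof: F_a is real entire of order < 2 (kernel
Φ/(1+u²/a²) is de Bruijn-admissible: `thm10_holds`), differentiation under the integral gives F_a''
= −∫u²Φ/(1+u²/a²)cos(zu) hence F_a − F_a''/a² = H_0; (1 + D/a)F = a⁻¹e^{−az}(e^{az}F)' and for h =
e^{az}F real entire of order < 2 with only real zeros, Im(h'/h) ≠ 0 off ℝ (`im_mul_im_logDeriv_le`,
`strictMonoOn_norm_sq_vertical`; zero-free case via `im_logDeriv_eq_zero_of_forall_ne_zero`), so h'
and (1+D/a)F have only real zeros and are again real entire of order < 2; repeat with (1 − D/a).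
[difficulty: provable-now] [Bruijn1950, Cardon2001, Titchmarsh1986] STATUS: PROVED
(`UniversalFactorStandalone.laguerreLift`).
#9 MixedFactorReduction (support) — Real-rootedness propagates UP the divisibility order of
universal factors, so the Laplace ray is the whole non-Gaussian loophole: for t ≥ 0, a multiset s of
positive rates containing a, if the transform of e^{−tu²}Φ(u)/∏_{b∈s}(1+u²/b²) has only real zeros
then so has F_a. Proof: multiply the kernel by the universal factor e^{tu²} (de Bruijn Thm 13 with Δ
= 0, PROVED: `rootsInStrip_zero_gaussian`; the kernel is admissible) and then apply (1 − D²/b²) for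
each b ∈ s ∖ {a} as in LaguerreLift. With `rodgers_tao_holds` (pure Gaussian rays dead) this shows
GN for all universal factors ⇔ GN on the Laplace ray. [difficulty: M] [Bruijn1950,
BrandenChasse2017, RodgersTaoFMP2020] STATUS: proved in tree
(`UniversalFactor.mixedFactorReduction`, Theorems/UniversalFactorMixedFactorReduction.lean); the
item is open only for the cyclic-render reason recorded in its docstring.
#9 WideKernelTail (support) — The engine of WideKernelNoGo: for 0 < a < π/8, e^{ax}F_a(x) → a∫₀^∞
H_0(y)cosh(ay)dy as x → +∞. Proof: F_a = (a/2)∫ℝ H_0(x−y)e^{−a|y|}dy (Fubini; 1/(1+u²/a²) is the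
Fourier transform of the Laplace density; H_0 even), split at y = x, dominated convergence with
|H_0(w)| ≪ w^A e^{−πw/8} (equivalently: residue theorem on the strip 0 ≤ Im u ≤ c, a < c < π/8,
`integral_horizontal_sub_eq_sum_of_simplePoles`, with Φ continued via its theta series).
[difficulty: provable-now] [Titchmarsh1986, Bruijn1950] STATUS: PROVED
(`UniversalFactorStandalone.wideKernelTail`).
#9 LehmerPointNoGo (support) — Calibration point of the medium window (certified computation, the
cheapest new theorem of the route): F_16 has a non-real zero — expected within 0.1 of z = 14010.16,
where Laplace(16)-smoothing (standard deviation √2/16 = 0.088 > half the z-gap 0.0377) fills the dip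
of H_0 between Lehmer's zeros 2γ = 14010.126, 14010.201 while Rouché on the box |Re z − 14010.16| ≤
0.6, |Im z| ≤ 0.6 keeps the local count 2. [difficulty: M] [CsordasSmithVarga1994, Polymath2019]
STATUS: witness located numerically, z ≈ 14010.1634 + 0.0797i (Disproof.lean §6A); t-side
certificate engine landed (Theorems/UniversalFactorLehmerDefs, …Representation, …Quadrature,
…CoreBounds, …Tails, …CheckerDefs); consumer `UniversalFactor.lehmerPointNoGo_of_certificate`.
#9 ExceptionalWideNoGo (support) — The exceptional wide directions, completing GN on (0, π/8): if 0
< a < π/8 and ∫₀^∞H_0(x)cosh(ax)dx = 0 (the residue at u = ia vanishes; such a form a discrete set,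
possibly empty, accumulating at most at π/8) then F_a still has a non-real zero. Here F_a(x) =
−a∫₀^∞ H_0(x+v)sinh(av)dv decays like e^{−πx/8} and the mechanism is the narrow one (m(u*_n) nearly
resonant at n ≈ N: tail-dominated, band-limited), not the residue. [difficulty: L] [Cardon2001,
Dobner2021] STATUS: non-vacuous — the residue Φ_ℂ(ia) changes sign on (0.31, 0.33)
(`UniversalFactor.PhiICert.re_tsum_pos_031` / `re_tsum_neg_033`; a₀ ≈ 0.3194, unique on (0, π/8)),
and the j012972 witness map exhibits a lost close pair at every grid value of a ∈ [0.30, 39.7]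
around a₀, adjacent values sharing witnesses.

TWO-LAYER PLAN. Foreseen glued splits (nothing filed now): NarrowKernelNoGo ⇐ NarrowEffectiveRS
(effective m-weighted Riemann–Siegel formula for F_a, uniform in a ≥ 32, heights T ≥ e^{Ca}) →
NarrowBandLimit (mean values: ∫|G'|² ≤ (ca)²∫|G|², fourth moment, thin-rectangle count) →
NarrowKernelNoGo. MediumKernelNoGo ⇐ MediumLow (π/8 ≤ a ≤ 6: band-limit/head-term heights and low
close pairs) → MediumLehmer (6 ≤ a ≤ 32 from the pair at γ ≈ 7005 with a-continuity) →
MediumKernelNoGo. [Superseded 2026-08-16 by the lead's two pointwise stubs: stub_lowLaguerre on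
[π/8, A_L] (u-side Laguerre-form certificate) and stub_highDip on [A_L, 32] (t-side dip certificate
at the Lehmer point), A_L ∈ [1, 1.5] — Cruxes/MediumKernelNoGo/PICKED.md.] WideKernelNoGo ⇐
WideKernelTail → WideInfinitelyManyZeros (order < 2, not
exponential type) → WideKernelNoGo.

KILL CRITERIA. (i) LaplaceLoophole PROVED for some a: RH follows through the assembly — the route
succeeds outright (not expected). (ii) NarrowKernelNoGo + MediumKernelNoGo + WideKernelNoGo +
ExceptionalWideNoGo proved: the target is refuted (typed kill path in Sketch.lean); close `--reason
refuted:LaplaceLoophole` with census 'GN holds on the whole universal-factor cone', and promote the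
four theorems to `Literature/Barriers/RiemannHypothesis/UniversalFactorNewman` (extends
NewmanConjecture; constrains LeeYang/TotalPositivity/cone cards: no representation Ξ = T[Ψ] with T a
non-trivial universal-factor operator and Ψ provably LP). (iii) Pivot: if the cheapest falsifier
shows NO sign-change deficit for F_1 at t ~ 2000 and the Lehmer pair survives a = 16, the
smoothing/band-limit analysis is wrong; drop Narrow/Medium as stated, keep WideKernelNoGo +
LaguerreLift, and re-file the narrow question as Cardon's open problem with the charge identity
only. — NOT TRIGGERED (2026-08-16): the falsifier came out the other way (deficits present and
growing with height; the Lehmer pair is lost at a = 16 and 32 and survives at 40, measured a* =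
37.473). (iv) Moot: a proof elsewhere that Ξ ∉ image of any non-trivial LP-preserver acting on LP (a
general 'extreme point' theorem) supersedes the route.

NOT DECOMPOSED YET. No effective-asymptotics lemmas (saddle contours for Φ·m, uniformity in a), no
mean-value lemmas, no certificate format for F_a-boxes (would reuse
Literature/Analysis/ValidatedNumerics), no treatment of the boundary a = π/8 beyond its inclusion in
the medium window, no cosh/sech rays (S = cosh(hu): covered by MixedFactorReduction only through the
product formula cosh = ∏(1 + 4h²u²/((2k−1)²π²)), i.e. reduces to Laplace rays — noted, not filed),
no infinite-product universal factors (limits via Hurwitz), no quantitative form of GN (proportion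
of non-real zeros → 1), no positive-side items beyond the target (nobody should try to prove X
before MediumKernelNoGo's numerics are in).

CHEAPEST FALSIFIER. kit job (mpmath, minutes; compute socket was absent at filing, so it is the
route's first job): tabulate H_0 on a grid from ball/mp ξ-values and form F_a = H_0 * Laplace(a) by
discrete convolution; (1) a = 1, t ∈ [2000, 2200]: count sign changes of F_1 against N(2200) −
N(2000) (prediction: a deficit of tens — band-limit onset t ≈ 2πe^{4} ≈ 343); (2) a ∈ {16, 32, 40}
on t ∈ [7004, 7006]: the Lehmer sign-change pair disappears for 16 and 32, survives for 40
(threshold 2√2/0.0754 = 37.5); (3) a = 0.3 < π/8: no sign change of F_{0.3} beyond some x₀ unless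
∫H_0 cosh(0.3x)dx ≈ 0. Outcome (1) no deficit AND (2) pair survives at 16 kills cruxes 2–3 as stated
(pivot (iii)); outcome (3) failing kills crux 4's normalisation. A literature kill: any paper
deciding Cardon's Q7 or defining a Newman-type constant for (1 − D²/a²)⁻¹ / cos(hD)⁻¹ (searched,
none found). OUTCOME (2026-08-15/16; kit j004819/j004904 uf-lehmer, j005074/j005077 uf-lowheight,
j005080 atlas, j012857 deficit table, j012972 witness map; Arb ζ cross-checked against mpmath): (1)
deficits confirmed — below t = 300 already F_1 has 99 sign changes against 138 zeros and F_{π/8}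
only 20, and the deficit grows with height at every probed a ≤ 32 up to t = 10⁶; (2) confirmed
exactly — lost at 16 and 32, survives at 40, threshold a* = 37.473 (quadratic model 37.51); (3)
superseded — the wide regime is PROVED (wideKernelNoGo) and the exceptional residue zero a₀ ≈ 0.3194
exists. No pivot: cruxes 2–3 stand as stated, and no a in (0, 39.7] escapes generalised Newman.

NUMBERS. Strip of Φ (RT normalisation): |Im u| < π/8 = 0.3927 (Titchmarsh's Φ: π/4); H_0(x) ≍
x^{7/4}e^{−πx/8}|Z(x/2)|. Lehmer pair γ = 7005.0629, 7005.1006: γ-gap 0.0377, z-gap 0.0754, local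
mean z-spacing 4π/log(7005/2π) = 1.79; quadratic local model loses its real zeros under Laplace(a)
iff 2/a² > (0.0754/2)², i.e. a < 37.5. Riemann–Siegel weights after division: m(u*_n) = a²/(a² +
(½log(N/n) + iπ/8)²), N = √(t/2π); head/tail weight ratio 1 + log²(t/2π)/(64a²)… = 2 at t = 2πe^{4a}
(a = 1: 343; 2: 1.9·10⁴; 3: 1.0·10⁶; 8: 4.9·10¹⁴; 32: 10^{56}). Λ_DBN ∈ [0, 0.2] (rodgers_tao_holds;
PlattTrudgian2021). RH verified to 3·10¹² (PlattTrudgian2021) — irrelevant to X but bounds where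
certified F_a-zeros can use real H_0-zeros as anchors.

DEFINITION REQUESTS. Wanted (convenience, not blocking):
`Literature.NumberTheory.LFunctions.deBruijnHDiv (m : ℝ → ℝ) (z : ℂ) : ℂ := ∫ u in Set.Ioi 0,
((deBruijnPhi u / m u : ℝ) : ℂ) * Complex.cos (z * u)` (transform of Φ divided by a kernel
multiplier) with the lemma deBruijnHDiv 1 = deBruijnH 0, so that later items read `HasOnlyRealZeros
(deBruijnHDiv (fun u => 1 + u^2/a^2))`; and a complex-variable continuation `deBruijnPhiC : ℂ → ℂ`
of Φ on |Im u| < π/8 with Φ(ia) = (2/π)∫₀^∞ H_0(x)cosh(ax)dx. Cite facts wanted: none beyond the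
tree (Cardon2001 Thm 1/3 are forward statements, not used).

Novelty: Searches (2026-08-15): zbMATH 'de Bruijn-Newman constant' (27: all Gaussian ray / Selberg-class /
Stopple L-families), 'convolution transform Laguerre-Polya class zeros' (1: Cardon2001), 'Cardon
Fourier transforms only real zeros' (2: Cardon2004, Dimitrov–Rusev survey zbl:1230.42003), 'complex
zero decreasing sequences' (10: Craven–Csordas CZDS, Csordas 2003/2007/2008 on linear operators and
ξ — all forward/CZDS), 'universal factors real zeros trigonometric integrals' (0), 'Laguerre-Polya
class inverse operator non-real zeros' (0), 'Newman conjecture generalized kernel' (0 relevant); lit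
frontier RiemannHypothesis --since 2020 (30 descendants; DBN items only:
doi:10.1016/j.cam.2025.117304, 'Λ ≤ 0.1965' 2026); lit bridges --cross any (nothing on this line);
lit galaxy search 'universal factors de Bruijn real zeros' / 'Fourier transforms having only real
zeros Cardon' --star all (0 substring hits; pdf/crabby timed out once); lit vsearch (books only);
Cardon2001 READ pp. 8–10 (§3 Examples and questions). OpenAlex/S2/arXiv were rate-limited (429)
today; the card's refuter audit (2026-08-15) had read Cardon2001 in full, NewmanWu2020 §4,
Branden–Chasse arXiv:1402.2795, Lagarias math/0601653.
Nearest prior art found: Cardon2001 (doi:10.1090/s0002-9939-01-06351-1) §3 Question 7 p.1733 — the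
loophole X as a question ('Can Ξ be realized as G∗dF with G ∈ LP? This would prove RH! However, it
seems unlikely…'), undecided; RodgersTaoFMP2020 / Dobner2021 (arXiv:2005.05142) — GN on the Gauss  [refs: 10.1016/j.cam.2025.117304, 10.1090/s0002-9939-01-06351-1, 1402.2795, 2005.05142, doi:10.1016/j.cam.2025.117304, doi:10.1090/s0002-9939-01-06351-1, Cardon2001, Cardon2004, NewmanWu2020, RodgersTaoFMP2020, Dobner2021, Bruijn1950, BrandenChasse2017, CsordasSmithVarga1994, KiKimLee2009]

Barriers (technique_class: universal-factors, PF-smoothing, RS-reweighting, Laguerre): - technique_class: universal-factors, PF-smoothing, RS-reweighting, Laguerre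
- Literature.Barriers.RiemannHypothesis.NewmanConjecture: applies as the Gaussian special case and
is EXTENDED, not evaded: the thesis X lives exactly in the barrier's blind spot ((1+u²/a²)⁻¹ is not
comparable with e^{λu²} in the universal-factor order, so Λ ≥ 0 says nothing about F_a), and the
route's expected product is the barrier's generalisation to every Pólya-frequency direction
(UniversalFactorNewman); the bet is two-sided: either a direction escapes (RH) or the catalogue
gains a cone-wide no-go.
- Literature.Barriers.RiemannHypothesis.JensenPolynomials: the Farmer-type trap (finite-shift
information is RH-free) applies to MediumKernelNoGo — a finite certified window says nothing about a
→ ∞ — and is acknowledged: all asymptotic content sits in NarrowKernelNoGo; conversely our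
'infinitely many non-real zeros' statements are the analogue of Kim's theorem read backwards and
carry no RH claim.
- Literature.Barriers.RiemannHypothesis.DavenportHeilbronn: used as a RESOURCE rather than met: crux
2's mechanism is precisely that a functional-equation object without the critical n^{−1/2} balance
(the m-reweighted Riemann–Siegel sum) has off-axis zeros; the route makes no Euler-product-free
claim towards RH — its only RH-ward step (LaguerreLift) is an honest implication from a hypothesis
expected false.
- Literature.Barriers.RiemannHypothesis.DeBrangesPositivity: not engaged (no de Branges space, no
pos

History (route lifecycle, newest last):
- 2026-08-15T22:52:20Z · rev 3: restated LaguerreLift (stmt-RiemannHypothesis-2579 proved), Assembly (stmt-RiemannHypothesis-2584 proved) — route-repair (glue-native-fail, unit rglue-RiemannHypothesis-UniversalFact-2d4ede49): CAUSE — items 2579 LaguerreLift / 2584 Assembly were closed 22:23Z --by de (planner-rglue-RiemannHypothesis-UniversalFact-2d4ede49-0)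
- 2026-08-16T00:54:35Z · rev 5: restated MixedFactorReduction (stmt-RiemannHypothesis-2580 proved), WideKernelTail (stmt-RiemannHypothesis-2581 proved) — route-repair (glue.unproved; unit rbadge-RiemannHypothesis-UniversalFact-2d4ede49-g2): CAUSE = the rev-3 gate bug again — items 2580 MixedFactorReduction / 2581 (planner-rbadge-RiemannHypothesis-UniversalFact-2d4ede49-g2-0)
- 2026-08-16T04:16:35Z · AUTO-CRUX (backfill): LaplaceLoophole — hypotheses of the deciding theorem that nothing in the route derives are cruxes (operator:999:1085951)
- 2026-08-16T18:30:29Z · BROKEN — LaplaceLoophole (stmt-RiemannHypothesis-2575, crux) refuted by Summit.RiemannHypothesis.RiemannHypothesis.Theorems.UniversalFactorLaplaceLoophole_refuted @ 7822bbd143ca (refuter-lscan-RiemannHypothesis-2575-r081616-0)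
- 2026-08-16T18:41:21Z · CLOSED refuted — refuted:stmt-RiemannHypothesis-2575 (LaplaceLoophole) by Summit.RiemannHypothesis.RiemannHypothesis.Theorems.UniversalFactorLaplaceLoophole_refuted (planner-rfix-RiemannHypothesis-UniversalFact-2d4ede49-0)

sub-problem: RiemannHypothesis · status: closed(refuted) · opened planner-plancard-RiemannHypothesis-RiemannHyp-595f5fc0-0 2026-08-15T11:05:45Z · rev 10 · ledger route-RiemannHypothesis-UniversalFactor
GENERATED by the gate from the ledger (D-0016/17). Provers cite these decls: `theorem foo : Summit.RiemannHypothesis.RiemannHypothesis.Theses.UniversalFactor.<Decl> := …` in Summits/RiemannHypothesis/RiemannHypothesis/Theorems/<Name>.lean.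
-/

namespace Summit.RiemannHypothesis.RiemannHypothesis.Theses.UniversalFactor

open scoped BigOperators Topology Manifold Classical MeasureTheory ProbabilityTheory Matrix InnerProductSpace ComplexConjugate ContinuousMap
open Filter Set Function TopologicalSpace MeasureTheory

attribute [summit_statement] _root_.Summit.RiemannHypothesis

open Summit

/-- item stmt-RiemannHypothesis-2575 · crux (kind.auto-crux: conjecture-grade) · rank 0 · closed · refuted by Summit.RiemannHypothesis.RiemannHypothesis.Theorems.UniversalFactorLaplaceLoophole_refuted @ 7822bbd143ca (refuter) · by planner
why it might fail: Expected FALSE at every a; numerically dead on (0,39.7]: a<π/8, Φ(ia)≠0 refuted in tree (wideKernelNoGo); each a∈[0.30,39.7] has an exhibited lost close pair of H_0-zeros (j012972: 7005→a*=37.47, 17143.8→40.0); larger a lose pairs at height log(t/2π)≈2.3a (μ<0.52 known on RH). True at ONE a ⇒ RH.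
sources: Cardon2001, RodgersTaoFMP2020, Dobner2021, Bruijn1950, CsordasSmithVarga1994, arXiv:1505.05350
[target] X: for some a > 0 the Laplace(a)-smoothed transform F_a(z) = ∫₀^∞ Φ(u)(1+u²/a²)⁻¹cos(zu)du
has only real zeros (Cardon's Question 7 on the minimal non-Gaussian universal factors; by
MixedFactorReduction + Λ ≥ 0 this is the whole universal-factor loophole). -/
@[route_item "route-RiemannHypothesis-UniversalFactor"]
def LaplaceLoophole : Prop :=
  ∃ a : ℝ, 0 < a ∧ Literature.NumberTheory.LFunctions.HasOnlyRealZeros (fun z : ℂ => ∫ u in Set.Ioi (0:ℝ), ((Literature.NumberTheory.LFunctions.deBruijnPhi u / (1 + u ^ 2 / a ^ 2) : ℝ) : ℂ) * Complex.cos (z * u))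

/-- item stmt-RiemannHypothesis-2576 · crux · rank 2 · closed · proved by Summit.RiemannHypothesis.RiemannHypothesis.Theorems.UniversalFactor.narrowKernelNoGo (prover) · by planner
why it might fail: Each FIXED a dies by a lost pair (7005: a<37.47; 17143.8: a<40.0; closer pairs above), but ∀a≥32 needs a-UNIFORMITY: no zero dynamics off the heat ray; band-limit deficit needs an a-uniform effective RS formula for the divided kernel; pair route needs μ<μ_c gaps in every window (0.5155 known on RH).
sources: RodgersTaoFMP2020, Dobner2021, arXiv:1901.06596, arXiv:1505.05350, Polymath2019, MontgomeryVaughan1974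
[crux] Generalised Newman, narrow kernels: for every a ≥ 32, F_a has a non-real zero (expected: ≫ T
log T of its zeros up to height T are non-real once log T ≫ a). Proposed proof = 'Dobner for the
Laplace ray': (i) effective Riemann–Siegel/saddle asymptotics for the modified kernel Φ(u)a²/(a²+u²)
(poles ±ia stay outside the deformation region 0 ≤ Im u ≤ π/8; templates: Polymath15 effective A+B,
in-tree KKL files), F_a(x) = A(t)·2Re[e^{iθ(t)}Σ_{n≤N} m(u*_n) n^{−1/2−it}] + O(A t^{−1/4}); (ii)
the weights m(u*_n) = a²/(a²+(½log(N/n)+iπ/8)²) form a Lorentzian window of width ~a below log N, so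
on [T,2T] the main term G has ∫|G'|² ≤ (c a)²∫|G|² and a fourth moment of the right order
(Montgomery–Vaughan), giving an interval I of ≥ 3 mean spacings with |G| ≥ rms/4 of one sign once
log T ≥ C·a; (iii) argument principle on I × [−1,1] where the n = 1 term dominates off the axis: ≥ 2
zeros inside, none real. Alternative handles: the card's interlacing-charge identity; the
phase/Lehmer mechanism under pair-correlation-type input (`MontgomeryPairCorrelation.smallGaps`).
[difficulty: XL] -/
@[route_item "route-RiemannHypothesis-UniversalFactor"]
def NarrowKernelNoGo : Prop :=
  ∀ a : ℝ, 32 ≤ a → ¬ Literature.NumberTheory.LFunctions.HasOnlyRealZeros (fun z : ℂ => ∫ u in Set.Ioi (0:ℝ), ((Literature.NumberTheory.LFunctions.deBruijnPhi u / (1 + u ^ 2 / a ^ 2) : ℝ) : ℂ) * Complex.cos (z * u))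

/-- item stmt-RiemannHypothesis-2577 · crux · rank 3 · closed · proved by Summit.RiemannHypothesis.RiemannHypothesis.Theorems.UniversalFactor.OneSidedAverageSignTest.MediumKernelNoGo_proof @ 768f34e8c7e1 (prover) · by planner
why it might fail: Truth numerically settled, NO escaping a: cdisprove NO-KILL on all of [π/8,32] (Lehmer-7005 zero 14010.16+i·y(a) tracked on [1.5,37.47), winding no. 1 at a=3,6,16,32; low-height zeros x<250 for a≤1.5). Risk is certification only: a-uniform interval enclosures, e^{-πx/8} scale, Lean checker.
sources: CsordasSmithVarga1994, Polymath2019, PlattTrudgian2021, arXiv:1904.12438, doi:10.1090/s0025-5718-2011-02472-5, Cardon2001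
[crux] Generalised Newman, medium kernels, by certified computation: for every a with π/8 ≤ a ≤ 32,
F_a has a non-real zero. Plan: finitely many certified non-real zeros z_j(a) (interval arithmetic
for F_a(z) = (a/2)∫ H_0(z−y)e^{−a|y|}dy from ball-arithmetic ξ, argument principle on small boxes)
plus a-continuity tracking on overlapping a-intervals: a ∈ [π/8, ~3] from the band-limited regime at
heights t ≤ 2πe^{4a}·C ≤ 10⁶ (for a just above π/8 even t ≤ 400: the head term
(a/2)e^{−ax}∫H_0e^{aw} dominates and F_a > 0 below X₀(a) while N(X₀) zeros sit in the disc); a ∈ [3,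
6] from low close pairs (z-gap < 2.8/a with 1/a ≤ 0.1 × spacing) or band-limit heights ≤ 10^{11}; a
∈ [6, 32] from Lehmer's pair γ = 7005.063/7005.101 (z-gap 0.0754 < 2√2/a for a < 37.5; 1/a ≤ 0.17 ≪
spacing 1.79): the Laplace variance 2/a² fills the dip, Rouché on a box of size ~1 preserves the
local count 2. [deps: LehmerPointNoGo] [difficulty: L] -/
@[route_item "route-RiemannHypothesis-UniversalFactor", crux]
def MediumKernelNoGo : Prop :=
  ∀ a : ℝ, Real.pi / 8 ≤ a → a ≤ 32 → ¬ Literature.NumberTheory.LFunctions.HasOnlyRealZeros (fun z : ℂ => ∫ u in Set.Ioi (0:ℝ), ((Literature.NumberTheory.LFunctions.deBruijnPhi u / (1 + u ^ 2 / a ^ 2) : ℝ) : ℂ) * Complex.cos (z * u))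

/-- item stmt-RiemannHypothesis-2578 · support · rank 4 · closed · proved by Summit.RiemannHypothesis.RiemannHypothesis.Theorems.UniversalFactorStandalone.wideKernelNoGo (prover) · by planner
why it might fail: Low risk, new but elementary: needs the decay |H_0(x)| ≪ x^A e^{−πx/8} (Ξ(t) ≪ t^{7/4}e^{−πt/4}) to justify F_a = H_0 * Laplace(a) and dominated convergence; fails only through a normalisation slip (π/8 is the RT strip; Titchmarsh's is π/4).
sources: Bruijn1950, Titchmarsh1986, RodgersTaoFMP2020
[crux] Generalised Newman, wide kernels (regime A): for 0 < a < π/8, if ∫₀^∞ H_0(x)cosh(ax)dx ≠ 0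
(i.e. Φ(ia) ≠ 0; Φ continues to |Im u| < π/8) then F_a has a non-real zero — in fact infinitely
many: by WideKernelTail F_a(x) = a e^{−a|x|}(∫₀^∞H_0 cosh(a·) + o(1)), so F_a has finitely many real
zeros, while F_a is real entire of order < 2 (de Bruijn Thm 10, `thm10_holds`) and not of
exponential type (F_a(iy) = ∫Φ cosh(yu)/(1+u²/a²) ≥ c_U e^{yU} for every U since Φ > 0), hence has
infinitely many zeros (zero-free order-<2 real entire functions are e^{αz+β}: Borel–Carathéodory,
Mathlib `Complex.borelCaratheodory`). Each instance is a new barrier theorem: no WIDE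
Pólya-frequency smoothing of Ξ is Laguerre–Pólya. [deps: WideKernelTail] [difficulty: M] -/
@[route_item "route-RiemannHypothesis-UniversalFactor"]
def WideKernelNoGo : Prop :=
  ∀ a : ℝ, 0 < a → a < Real.pi / 8 → (∫ x in Set.Ioi (0:ℝ), Literature.NumberTheory.LFunctions.deBruijnH 0 (x : ℂ) * (Real.cosh (a * x) : ℂ)) ≠ 0 → ¬ Literature.NumberTheory.LFunctions.HasOnlyRealZeros (fun z : ℂ => ∫ u in Set.Ioi (0:ℝ), ((Literature.NumberTheory.LFunctions.deBruijnPhi u / (1 + u ^ 2 / a ^ 2) : ℝ) : ℂ) * Complex.cos (z * u))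

/-- `WideKernelNoGo` holds: proved by `Summit.RiemannHypothesis.RiemannHypothesis.Theorems.UniversalFactorStandalone.wideKernelNoGo`. -/
theorem WideKernelNoGo_holds : WideKernelNoGo := _root_.Summit.RiemannHypothesis.RiemannHypothesis.Theorems.UniversalFactorStandalone.wideKernelNoGo

-- earlier LaguerreLift (stmt-RiemannHypothesis-2579, replaced 2026-08-15T22:52:20Z -> stmt-RiemannHypothesis-13911): proved by Summit.RiemannHypothesis.RiemannHypothesis.Theorems.UniversalFactor.laguerreLift — ∀ a : ℝ, 0 < a → Literature.NumberTheory.LFunctions.HasOnlyRealZeros (fun z : ℂ => ∫ u in Set.Ioi (0:ℝ), ((Literature.NumberTheory.LFunctions.deBruijnPhi u / (1 + u ^ 2 / a ^ 2) : ℝ) : ℂ) * Co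
/-- item stmt-RiemannHypothesis-13911 · support · rank 9 · closed · proved by Summit.RiemannHypothesis.RiemannHypothesis.Theorems.UniversalFactorStandalone.laguerreLift (prover) · by planner
sources: Bruijn1950, Cardon2001, Titchmarsh1986
[support] The Laguerre lift — the LP-preserver step of the deciding theorem `closes` — restated over
the landed definition `Literature.NumberTheory.LFunctions.deBruijnHDiv` (F_a = deBruijnHDiv (fun u ↦
1 + u²/a²); `deBruijnHDiv_laplace_eq` is `rfl`, so this is DEFINITIONALLY the inline statement of
the replaced item stmt-RiemannHypothesis-2579): for every a > 0, if F_a has only real zeros then so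
has H_0 = (1 − D²/a²)F_a (two Hadamard-free Laguerre steps D ± a on real entire functions of order <
2; the degenerate alternatives are excluded by H_0 ≢ 0). PROVED IN TREE:
`Summit.RiemannHypothesis.RiemannHypothesis.Theorems.UniversalFactor.laguerreLift`
(Theorems/UniversalFactorLaguerreLift.lean) elaborates against this body verbatim (planner check
2026-08-15, Compat.lean rc 0). Re-filed OPEN only because a `--by` closure through a module that
imports this Theses file makes the gate render `import …Theorems.UniversalFactorLaguerreLift` + a
`_holds` link HERE, which is cyclic ('has already been declared', route NEEDS-MATERIALISE
2026-08-15T22:31Z) — the NymanBeurling rev-2 situation. Do NOT re-prove; close with `ledger workitem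
close <this item> --as proved --by Summit.RiemannHypothesis. -/
@[route_item "route-RiemannHypothesis-UniversalFactor"]
def LaguerreLift : Prop :=
  ∀ a : ℝ, 0 < a → Literature.NumberTheory.LFunctions.HasOnlyRealZeros (Literature.NumberTheory.LFunctions.deBruijnHDiv (fun u : ℝ => 1 + u ^ 2 / a ^ 2)) → Literature.NumberTheory.LFunctions.HasOnlyRealZeros (Literature.NumberTheory.LFunctions.deBruijnH 0)

/-- `LaguerreLift` holds: proved by `Summit.RiemannHypothesis.RiemannHypothesis.Theorems.UniversalFactorStandalone.laguerreLift`. -/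
theorem LaguerreLift_holds : LaguerreLift := _root_.Summit.RiemannHypothesis.RiemannHypothesis.Theorems.UniversalFactorStandalone.laguerreLift

-- earlier MixedFactorReduction (stmt-RiemannHypothesis-2580, replaced 2026-08-16T00:54:35Z -> stmt-RiemannHypothesis-14035): proved by Summit.RiemannHypothesis.RiemannHypothesis.Theorems.UniversalFactor.mixedFactorReduction — ∀ (t a : ℝ) (s : Multiset ℝ), 0 ≤ t → a ∈ s → (∀ b ∈ s, 0 < b) → Literature.NumberTheory.LFunctions.HasOnlyRealZeros (fun z : ℂ => ∫ u in Set.Ioi (0:ℝ), ((Real.exp (-(t * u ^ 2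
/-- item stmt-RiemannHypothesis-14035 · support · rank 9 · closed · proved by Summit.RiemannHypothesis.RiemannHypothesis.Theorems.UniversalFactorStandalone.mixedFactorReduction (prover) · by planner
sources: Bruijn1950, BrandenChasse2017, RodgersTaoFMP2020
[support] Real-rootedness propagates UP the divisibility order of universal factors, so the Laplace
ray is the whole non-Gaussian loophole — restated over the landed
`Literature.NumberTheory.LFunctions.deBruijnHDiv` (conclusion F_a = deBruijnHDiv (fun u ↦ 1 +
u²/a²); `Iff.rfl` with the replaced item stmt-RiemannHypothesis-2580): for t ≥ 0, a multiset s of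
positive rates containing a, if the transform of e^{−tu²}Φ(u)/∏_{b∈s}(1+u²/b²) has only real zeros
then so has F_a (Gaussian factor removed by de Bruijn Thm 13, `rootsInStrip_zero_gaussian`; then one
Hadamard-free Laguerre step (1 − D²/b²) per b ∈ s ∖ {a}; with `rodgers_tao_holds` this makes
¬LaplaceLoophole ⇔ GN on the whole finite universal-factor cone,
`UniversalFactor.not_laplaceLoophole_iff_universalFactorNewman` in
Theorems/UniversalFactorConeReduction.lean). PROVED IN TREE:
`Summit.RiemannHypothesis.RiemannHypothesis.Theorems.UniversalFactor.mixedFactorReduction`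
(Theorems/UniversalFactorMixedFactorReduction.lean) proves this body verbatim (planner Sketch.lean
rc 0, 2026-08-16). Re-filed OPEN only because closing stmt-2580 `--by` a decl of a module that
imports this Theses file made the gate render `import …Theorems.Univers -/
@[route_item "route-RiemannHypothesis-UniversalFactor"]
def MixedFactorReduction : Prop :=
  ∀ (t a : ℝ) (s : Multiset ℝ), 0 ≤ t → a ∈ s → (∀ b ∈ s, 0 < b) → Literature.NumberTheory.LFunctions.HasOnlyRealZeros (fun z : ℂ => ∫ u in Set.Ioi (0:ℝ), ((Real.exp (-(t * u ^ 2)) * Literature.NumberTheory.LFunctions.deBruijnPhi u / (s.map fun b => 1 + u ^ 2 / b ^ 2).prod : ℝ) : ℂ) * Complex.cos (z * u)) → Literature.NumberTheory.LFunctions.HasOnlyRealZeros (Literature.NumberTheory.LFunctions.deBruijnHDiv (fun u : ℝ => 1 + u ^ 2 / a ^ 2))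

/-- `MixedFactorReduction` holds: proved by `Summit.RiemannHypothesis.RiemannHypothesis.Theorems.UniversalFactorStandalone.mixedFactorReduction`. -/
theorem MixedFactorReduction_holds : MixedFactorReduction := _root_.Summit.RiemannHypothesis.RiemannHypothesis.Theorems.UniversalFactorStandalone.mixedFactorReduction

-- earlier WideKernelTail (stmt-RiemannHypothesis-2581, replaced 2026-08-16T00:54:35Z -> stmt-RiemannHypothesis-14036): proved by Summit.RiemannHypothesis.RiemannHypothesis.Theorems.wideKernelTail — ∀ a : ℝ, 0 < a → a < Real.pi / 8 → Filter.Tendsto (fun x : ℝ => (Real.exp (a * x) : ℂ) * ∫ u in Set.Ioi (0:ℝ), ((Literature.NumberTheory.LFunctions.deBruijnPhi u / (1 + u ^ 2 / a ^ 2) : ℝ) : ℂ) * Complex.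
/-- item stmt-RiemannHypothesis-14036 · support · rank 9 · closed · proved by Summit.RiemannHypothesis.RiemannHypothesis.Theorems.UniversalFactorStandalone.wideKernelTail (prover) · by planner
sources: Titchmarsh1986, Bruijn1950
[support] The engine of WideKernelNoGo — restated over the landed
`Literature.NumberTheory.LFunctions.deBruijnHDiv` (F_a = deBruijnHDiv (fun u ↦ 1 + u²/a²); `Iff.rfl`
with the replaced item stmt-RiemannHypothesis-2581): for 0 < a < π/8, e^{ax}F_a(x) → a∫₀^∞
H_0(y)cosh(ay)dy as x → +∞ (F_a = (a/2)∫ℝ H_0(x−y)e^{−a|y|}dy by Fubini, then dominated convergence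
with |H_0(w)| ≪ e^{−b|w|}, b < π/8). PROVED IN TREE:
`Summit.RiemannHypothesis.RiemannHypothesis.Theorems.wideKernelTail`
(Theorems/UniversalFactorLaplaceLoopholeWideTail.lean, via `tendsto_exp_mul_deBruijnHDiv_laplace`,
whose statement IS this body) — planner Sketch.lean rc 0, 2026-08-16; its consumer
`UniversalFactor.wideKernelNoGo_of_wideKernelTail` / `UniversalFactor.wideKernelNoGo` (p69962)
re-elaborates unchanged. Re-filed OPEN only because closing stmt-2581 `--by` a decl of a module that
imports this Theses file made the gate render that module as an import + a `_holds` link HERE =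
import cycle (route NEEDS-MATERIALISE 2026-08-15T23:14Z). Do NOT re-prove; do NOT `workitem close
--by` any decl whose module (transitively) imports this file until the gate renders such closures as
docstring links (or close via a Theses-free wra -/
@[route_item "route-RiemannHypothesis-UniversalFactor", crux]
def WideKernelTail : Prop :=
  ∀ a : ℝ, 0 < a → a < Real.pi / 8 → Filter.Tendsto (fun x : ℝ => (Real.exp (a * x) : ℂ) * Literature.NumberTheory.LFunctions.deBruijnHDiv (fun u : ℝ => 1 + u ^ 2 / a ^ 2) (x : ℂ)) Filter.atTop (nhds ((a : ℂ) * ∫ y in Set.Ioi (0:ℝ), Literature.NumberTheory.LFunctions.deBruijnH 0 (y : ℂ) * (Real.cosh (a * y) : ℂ)))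

/-- `WideKernelTail` holds: proved by `Summit.RiemannHypothesis.RiemannHypothesis.Theorems.UniversalFactorStandalone.wideKernelTail`. -/
theorem WideKernelTail_holds : WideKernelTail := _root_.Summit.RiemannHypothesis.RiemannHypothesis.Theorems.UniversalFactorStandalone.wideKernelTail

/-- item stmt-RiemannHypothesis-2582 · support · rank 9 · closed · moot by None · by planner
sources: CsordasSmithVarga1994, Polymath2019
[support] Calibration point of the medium window (certified computation, the cheapest new theorem of
the route): F_16 has a non-real zero — expected within 0.1 of z = 14010.16, where
Laplace(16)-smoothing (standard deviation √2/16 = 0.088 > half the z-gap 0.0377) fills the dip of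
H_0 between Lehmer's zeros 2γ = 14010.126, 14010.201 while Rouché on the box |Re z − 14010.16| ≤
0.6, |Im z| ≤ 0.6 keeps the local count 2. [difficulty: M] -/
@[route_item "route-RiemannHypothesis-UniversalFactor"]
def LehmerPointNoGo : Prop :=
  ¬ Literature.NumberTheory.LFunctions.HasOnlyRealZeros (fun z : ℂ => ∫ u in Set.Ioi (0:ℝ), ((Literature.NumberTheory.LFunctions.deBruijnPhi u / (1 + u ^ 2 / (16:ℝ) ^ 2) : ℝ) : ℂ) * Complex.cos (z * u))

/-- item stmt-RiemannHypothesis-2583 · support · rank 9 · closed · moot by None · by planner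
sources: Cardon2001, Dobner2021
[support] The exceptional wide directions, completing GN on (0, π/8): if 0 < a < π/8 and
∫₀^∞H_0(x)cosh(ax)dx = 0 (the residue at u = ia vanishes; such a form a discrete set, possibly
empty, accumulating at most at π/8) then F_a still has a non-real zero. Here F_a(x) = −a∫₀^∞
H_0(x+v)sinh(av)dv decays like e^{−πx/8} and the mechanism is the narrow one (m(u*_n) nearly
resonant at n ≈ N: tail-dominated, band-limited), not the residue. [difficulty: L] -/
@[route_item "route-RiemannHypothesis-UniversalFactor"]
def ExceptionalWideNoGo : Prop :=
  ∀ a : ℝ, 0 < a → a < Real.pi / 8 → (∫ x in Set.Ioi (0:ℝ), Literature.NumberTheory.LFunctions.deBruijnH 0 (x : ℂ) * (Real.cosh (a * x) : ℂ)) = 0 → ¬ Literature.NumberTheory.LFunctions.HasOnlyRealZeros (fun z : ℂ => ∫ u in Set.Ioi (0:ℝ), ((Literature.NumberTheory.LFunctions.deBruijnPhi u / (1 + u ^ 2 / a ^ 2) : ℝ) : ℂ) * Complex.cos (z * u))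

-- earlier Assembly (stmt-RiemannHypothesis-2584, replaced 2026-08-15T22:52:20Z -> stmt-RiemannHypothesis-13912): proved by Summit.RiemannHypothesis.RiemannHypothesis.Theorems.UniversalFactor.assembly — (∃ a : ℝ, 0 < a ∧ Literature.NumberTheory.LFunctions.HasOnlyRealZeros (fun z : ℂ => ∫ u in Set.Ioi (0:ℝ), ((Literature.NumberTheory.LFunctions.deBruijnPhi u / (1 + u ^ 2 / a ^ 2) : ℝ) : ℂ) * Complex.c
/-- item stmt-RiemannHypothesis-13912 · assembly · rank 1 · closed · proved by Summit.RiemannHypothesis.RiemannHypothesis.Theorems.UniversalFactorStandalone.assembly (prover) · by planner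
sources: Cardon2001, Bruijn1950, Titchmarsh1986
[assembly] LaplaceLoophole → RiemannHypothesis, restated BY NAME over the target (definitionally the
inline form of the replaced item stmt-RiemannHypothesis-2584, `rfl`): a real-rooted Laplace-smoothed
transform F_a lifts through (1 − D²/a²) to a real-rooted H_0 = ξ(1/2 + iz/2)/8 (LaguerreLift), i.e.
RH (`riemannHypothesis_iff_hasOnlyRealZeros_deBruijnH_zero_holds`). PROVED IN TREE:
`Summit.RiemannHypothesis.RiemannHypothesis.Theorems.UniversalFactor.assembly` elaborates against
this body verbatim (Compat.lean rc 0). The deciding theorem `closes` of this file does not use this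
item (it takes LaplaceLoophole and LaguerreLift and invokes the proved RH ↔ H_0-real-rooted fact
directly); the item is kept because the Theorems file names the decl. Re-filed OPEN only for the
cyclic-render reason recorded on LaguerreLift. Do NOT re-prove; close with `ledger workitem close
<this item> --as proved --by
Summit.RiemannHypothesis.RiemannHypothesis.Theorems.UniversalFactor.assembly` once the gate renders
home-route closures as docstring links. [difficulty: done in tree] -/
@[route_item "route-RiemannHypothesis-UniversalFactor"]
def Assembly : Prop :=
  LaplaceLoophole → Summit.RiemannHypothesis

/-- `Assembly` holds: proved by `Summit.RiemannHypothesis.RiemannHypothesis.Theorems.UniversalFactorStandalone.assembly`. -/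
theorem Assembly_holds : Assembly := _root_.Summit.RiemannHypothesis.RiemannHypothesis.Theorems.UniversalFactorStandalone.assembly

end Summit.RiemannHypothesis.RiemannHypothesis.Theses.UniversalFactor
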